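import Summits.QuantumFields.YangMills.Theorems.BalabanUVNodesN14ConvexFibreCauchy
import Literature.MathematicalPhysics.QuantumFieldTheory.Balaban1983to89.T4LoopPullback

/-!
# BalabanUVNodes ∕ node N14 = NE1′ — THE FIBRE-GRADIENT LETTER ON THE LINEARISED MODEL: the pulled-back unit loop of `T4LoopPullback` has
# ℓ¹-mass `4·Lⁿ` and ℓ²-size `≤ 4·L^{(2−d)n}` (the young rate SQUARED, `θ₁ = L^{1−d}` BY NAME), and the cosine read-out observable
# `B₀·cos(φ b + ⟪w, x⟫)` carries the engine's four observable letters with gradient `B₀‖w‖`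

Cell `pub-ymgap`, HUMAN RULING D-0062 (Track A at full width), seat `pub-ymgap-dag-n14-c` (R134 ACCELERATION, strategy s1), generation 5;
route `Summits/QuantumFields/YangMills/Theses/BalabanUVNodes.lean` rev 16∕17 (cluster K3‴ `SpineGivenEndpointR13` = stmt-QuantumFields-19912,
`--supports … --as helper`); venue ruling R424 (`YangMills/Theorems`, namespace `YMDAG.N14.ConvexFibreLoopModel`).  Twelfth file of the convex-fibre
engine.  ADDITIVE — imports K (`…ConvexFibreCauchy`, the schema tower ⇒ `MatchingModConstants` ⇒ Cauchy generating functions) and the tree's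
`Literature/…/T4LoopPullback` (node O3c: `pull`, `sqBdry`, `loopPull_closed`, `abs_blockSum_sqBdry_le`, `rate_eq_zpow` — `θ₁ = L^{1−d}` per level,
PROVED there); THEOREMS ONLY (0 `def`), modifies nothing.

WHY.  Of the engine's four letters (K's header) the FIBRE-GRADIENT sizes `L K` are the one the tree already knows how to produce — in the LINEARISED
(abelian, angle-unit) model of Bałaban's averaging, which is `T4LoopPullback`'s world: the unit loop read on the fine field of a run with `n` more
levels is the linear functional `x ↦ ⟪w, x⟫` of the fine bond variables with `w = (pull L)^[n] ∂Sq₁(y)` — the average of the `K^d` parallel fine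
squares of side `K = Lⁿ` (`loopPull_closed`) — every bond carrying `|w_b| ≤ K·K^{−d} = θ₁ⁿ` (`abs_blockSum_sqBdry_le`).  The engine reads the
EUCLIDEAN norm of the fibre gradient, i.e. the ℓ²-size of `w`: this file adds the ℓ¹-count `Σ_b |w_b| ≤ 4K` (the `K^d` squares have `4K` bonds
each, weight `K^{−d}`), whence `Σ_b w_b² ≤ sup·ℓ¹ ≤ 4K^{2−d} = 4·L^{(2−d)n}` — the young rate SQUARED, geometric with ratio `L^{2−d} < 1` for
`d ≥ 3`: exactly the square-summability `Σ (L K)² < ∞` that K's `cauchySeq_genFun_of_schemaTower` asks of the gradients.  The observable of the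
model is the cosine read-out `G(b, x) = B₀·cos(φ b + ⟪w, x⟫)` (the real part of a `U(1)` Wilson loop: block-field angle `φ b` plus the fluctuation's
contribution), which carries the engine's observable letters with `L = B₀‖w‖`.

WHAT THIS IS.
* §1 [folklore ∘ `T4LoopPullback`]: `seg_nonneg`, `sum_seg_le` (a straight `K`-segment puts mass `≤ K` on any finite bond set), `sum_abs_rectBdry_le`
  (`≤ 2K₁ + 2K₂`), `sum_abs_blockSum_sqBdry_le` (`Σ_{b∈S} |w_b| ≤ 4K` for the averaged square), **`sum_abs_loopPull_le`** (`Σ_{b∈S} |((pull L)^[n] ∂Sq₁(y))_b|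
  ≤ 4·Lⁿ`), **`sum_sq_loopPull_le`** (`Σ_{b∈S} w_b² ≤ 4·Lⁿ·(Lⁿ·(Lⁿ)^{−d})`) and its closed form **`sum_sq_loopPull_le_zpow`** (`≤ 4·L^{(2−d)n}`), for EVERY
  finite bond set `S` (no summability bookkeeping: the chain is finitely supported, the bound is uniform in `S`).
* §2 [folklore] THE COSINE READ-OUT on `B × EuclideanSpace ℝ (Fin m)`: `measurable_cosReadOut`, `contDiff_cosReadOut`, `abs_cosReadOut_le` (`≤ B₀`),
  `hasFDerivAt_cosReadOut`, **`norm_fderiv_cosReadOut_le`** (`‖D_x G(b,·)‖ ≤ B₀‖w‖`) — the four observable letters of H∕J∕K; and the transfer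
  **`norm_sq_le_of_coords`**: if the fibre coordinates read the chain, `w i = c (ι i)` along an injection `ι : Fin m ↪ bonds`, then `‖w‖² ≤` any uniform
  bound on `Σ_{b∈S} (c b)²` — so `‖w‖² ≤ 4·L^{(2−d)n}` by §1.
* §3 [folklore] SUMMABILITY: `zpow_two_sub_lt_one` (`L ≥ 2`, `d ≥ 3` ⇒ `L^{2−d} < 1`), `summable_gradient_sq` (`‖w K‖² ≤ A·ρ^K`, `0 ≤ ρ < 1` ⇒
  `Σ (B₀‖w K‖)² < ∞`) — K's hypothesis `hL2` ON THE MODEL.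
* §4 THE INSTANCE **`cauchySeq_genFun_of_loopTower`**: K's `cauchySeq_genFun_of_schemaTower` with the observables `G K (b, x) = B₀·cos(φ K b + ⟪w K, x⟫)`
  (`φ K` measurable), gradient letters `B₀‖w K‖ ≤ L K`, the four observable hypotheses DISCHARGED by §2; what remains displayed: the schema `C` of the
  fibres, the defects `δ K`, `ε K`, the square-summability of `L K` (§3 on the model), the tower shape.

WHAT THIS IS NOT.  Everything here is PROVED (0 `sorry`, 0 named facts).  The LINEARISED model is `T4LoopPullback`'s caricature of [Balaban1985Averaging]
(14)∕(15) (straight averages, angle units; the contour corrections cancel on closed loops there, `pullC_eq_pull_of_isCycle`); Bałaban's averaging is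
non-linear and his fluctuation fields live on gauge-fixed axial subspaces — the identification of the engine's Euclidean fibre coordinates with fine
bond variables is the MODEL's, displayed as the hypothesis of `norm_sq_le_of_coords`.  Nothing of Bałaban's instantiated; N14 NOT discharged; the schema,
the two defects and the tower shape remain NODE O's ∕ NE5–NE7's letters; count-neutral.  One finite four-torus programme at fixed ε; NOT ℝ⁴, NOT OS,
NOT a mass gap, NOT Clay.
-/

noncomputable section

namespace YMDAG.N14.ConvexFibreLoopModel

open MeasureTheory ProbabilityTheory Set Filter Topology Finset
open scoped RealInnerProductSpace ENNReal NNReal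
open Literature.Analysis.FunctionSpaces (HasEntropyExpC1c)
open Literature.MathematicalPhysics.QuantumLattice (ZdEdge blockSites card_blockSites)
open Literature.MathematicalPhysics.QuantumFieldTheory.Balaban1983to89.T4LoopPullback (seg seg_apply rectBdry sqBdry sqBdry_eq pull loopPull_closed
  abs_blockSum_sqBdry_le rate_eq_zpow)
open Literature.MathematicalPhysics.QuantumFieldTheory.Balaban1983to89.T4CauchySum (genFun)
open YMDAG.N14.ConvexFibreCauchy (cauchySeq_genFun_of_schemaTower)

/-! ## §1 The pulled-back unit loop: ℓ¹-mass `4·Lⁿ`, ℓ²-size `4·L^{(2−d)n}` on every finite bond set -/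
section LoopPull

variable {d : ℕ}

/-- A straight segment chain is nonnegative bond by bond. [folklore] -/
theorem seg_nonneg (K : ℕ) (z : Fin d → ℤ) (μ : Fin d) (b : ZdEdge d) : 0 ≤ seg K z μ b := by
  rw [seg_apply]
  exact Finset.sum_nonneg fun j _ => by split_ifs <;> norm_num

/-- A straight `K`-segment puts total mass `≤ K` on ANY finite bond set (each of its `K` bonds contributes at most `1`). [folklore] -/
theorem sum_seg_le (K : ℕ) (z : Fin d → ℤ) (μ : Fin d) (S : Finset (ZdEdge d)) : ∑ b ∈ S, seg K z μ b ≤ K := by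
  simp only [seg_apply]
  rw [Finset.sum_comm]
  calc ∑ j ∈ range K, ∑ b ∈ S, (if b = (z + Pi.single μ (j : ℤ), μ) then (1 : ℝ) else 0)
      ≤ ∑ _j ∈ range K, (1 : ℝ) := Finset.sum_le_sum fun j _ => by
        rw [Finset.sum_ite_eq' S]
        split_ifs <;> norm_num
    _ = K := by simp

/-- … in absolute value. [folklore] -/
theorem sum_abs_seg_le (K : ℕ) (z : Fin d → ℤ) (μ : Fin d) (S : Finset (ZdEdge d)) : ∑ b ∈ S, |seg K z μ b| ≤ K := by
  rw [Finset.sum_congr rfl fun b _ => abs_of_nonneg (seg_nonneg K z μ b)]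
  exact sum_seg_le K z μ S

/-- The rectangle boundary `∂Rect_{K₁,K₂}` puts total mass `≤ 2K₁ + 2K₂` on any finite bond set. [folklore] -/
theorem sum_abs_rectBdry_le (K₁ K₂ : ℕ) (z : Fin d → ℤ) (μ ν : Fin d) (S : Finset (ZdEdge d)) :
    ∑ b ∈ S, |rectBdry K₁ K₂ z μ ν b| ≤ 2 * K₁ + 2 * K₂ := by
  have h1 := sum_abs_seg_le K₁ z μ S
  have h2 := sum_abs_seg_le K₂ (z + Pi.single μ (K₁ : ℤ)) ν S
  have h3 := sum_abs_seg_le K₁ (z + Pi.single ν (K₂ : ℤ)) μ S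
  have h4 := sum_abs_seg_le K₂ z ν S
  calc ∑ b ∈ S, |rectBdry K₁ K₂ z μ ν b|
      ≤ ∑ b ∈ S, (|seg K₁ z μ b| + |seg K₂ (z + Pi.single μ (K₁ : ℤ)) ν b| + |seg K₁ (z + Pi.single ν (K₂ : ℤ)) μ b| + |seg K₂ z ν b|) :=
        Finset.sum_le_sum fun b _ => by
          simp only [rectBdry, Pi.add_apply, Pi.sub_apply]
          have := abs_add_le (seg K₁ z μ b) (seg K₂ (z + Pi.single μ (K₁ : ℤ)) ν b)
          have := abs_sub (seg K₁ z μ b + seg K₂ (z + Pi.single μ (K₁ : ℤ)) ν b) (seg K₁ (z + Pi.single ν (K₂ : ℤ)) μ b)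
          have := abs_sub (seg K₁ z μ b + seg K₂ (z + Pi.single μ (K₁ : ℤ)) ν b - seg K₁ (z + Pi.single ν (K₂ : ℤ)) μ b) (seg K₂ z ν b)
          linarith
    _ = (∑ b ∈ S, |seg K₁ z μ b|) + (∑ b ∈ S, |seg K₂ (z + Pi.single μ (K₁ : ℤ)) ν b|) +
          (∑ b ∈ S, |seg K₁ (z + Pi.single ν (K₂ : ℤ)) μ b|) + ∑ b ∈ S, |seg K₂ z ν b| := by
        rw [Finset.sum_add_distrib, Finset.sum_add_distrib, Finset.sum_add_distrib]
    _ ≤ 2 * K₁ + 2 * K₂ := by linarith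

/-- **THE AVERAGED SQUARE HAS ℓ¹-MASS `≤ 4K`** [folklore]: the `K^d` parallel squares of side `K` based in one block, each weighted `K^{−d}`, put total
mass `≤ K^{−d}·K^d·4K = 4K` on any finite bond set. -/
theorem sum_abs_blockSum_sqBdry_le (K : ℕ) (hK : 0 < K) (y : Fin d → ℤ) (μ ν : Fin d) (S : Finset (ZdEdge d)) :
    ∑ b ∈ S, |(((K : ℝ) ^ d)⁻¹ • ∑ x ∈ blockSites K y, sqBdry K x μ ν) b| ≤ 4 * K := by
  have hKd : (0 : ℝ) < ((K : ℝ) ^ d)⁻¹ := inv_pos.2 (pow_pos (by exact_mod_cast hK) d)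
  have hsq : ∀ x, ∑ b ∈ S, |sqBdry K x μ ν b| ≤ 4 * K := fun x => by
    rw [sqBdry_eq]
    have := sum_abs_rectBdry_le K K x μ ν S
    linarith
  calc ∑ b ∈ S, |(((K : ℝ) ^ d)⁻¹ • ∑ x ∈ blockSites K y, sqBdry K x μ ν) b|
      ≤ ∑ b ∈ S, ((K : ℝ) ^ d)⁻¹ * ∑ x ∈ blockSites K y, |sqBdry K x μ ν b| := Finset.sum_le_sum fun b _ => by
        rw [Pi.smul_apply, Finset.sum_apply, smul_eq_mul, abs_mul, abs_of_pos hKd]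
        exact mul_le_mul_of_nonneg_left (Finset.abs_sum_le_sum_abs _ _) hKd.le
    _ = ((K : ℝ) ^ d)⁻¹ * ∑ x ∈ blockSites K y, ∑ b ∈ S, |sqBdry K x μ ν b| := by
        rw [← Finset.mul_sum, Finset.sum_comm]
    _ ≤ ((K : ℝ) ^ d)⁻¹ * ∑ _x ∈ blockSites K y, (4 * K : ℝ) :=
        mul_le_mul_of_nonneg_left (Finset.sum_le_sum fun x _ => hsq x) hKd.le
    _ = 4 * K := by
        rw [Finset.sum_const, card_blockSites, nsmul_eq_mul]
        push_cast
        field_simp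

/-- **THE PULLED-BACK UNIT LOOP HAS ℓ¹-MASS `≤ 4·Lⁿ`** [folklore ∘ `T4LoopPullback.loopPull_closed`]: for every `L ≥ 1`, `n`, base point `y`, plane
`(μ, ν)` and every finite bond set `S`, `Σ_{b∈S} |((pull L)^[n] ∂Sq₁(y))_b| ≤ 4·Lⁿ` (in angle units the loop of unit physical size has perimeter `4Lⁿ`
fine bonds' worth of mass). -/
theorem sum_abs_loopPull_le (L : ℕ) (hL : 0 < L) (n : ℕ) (y : Fin d → ℤ) (μ ν : Fin d) (S : Finset (ZdEdge d)) :
    ∑ b ∈ S, |((pull L)^[n] (sqBdry 1 y μ ν)) b| ≤ 4 * ((L ^ n : ℕ) : ℝ) := by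
  rw [loopPull_closed L hL n y μ ν]
  exact sum_abs_blockSum_sqBdry_le (L ^ n) (pow_pos hL n) y μ ν S

/-- **THE PULLED-BACK UNIT LOOP HAS ℓ²-SIZE `≤ 4·Lⁿ·(Lⁿ·(Lⁿ)^{−d})`** [folklore ∘ `T4LoopPullback.abs_blockSum_sqBdry_le`]: `w_b² = |w_b|·|w_b| ≤
(sup_b |w_b|)·|w_b| ≤ θ₁ⁿ·|w_b|` bond by bond, summed with `sum_abs_loopPull_le`. -/
theorem sum_sq_loopPull_le (L : ℕ) (hL : 0 < L) (n : ℕ) (y : Fin d → ℤ) (μ ν : Fin d) (S : Finset (ZdEdge d)) :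
    ∑ b ∈ S, ((pull L)^[n] (sqBdry 1 y μ ν)) b ^ 2 ≤ 4 * ((L ^ n : ℕ) : ℝ) * (((L ^ n : ℕ) : ℝ) * ((((L ^ n : ℕ) : ℝ)) ^ d)⁻¹) := by
  have hsup : ∀ b, |((pull L)^[n] (sqBdry 1 y μ ν)) b| ≤ ((L ^ n : ℕ) : ℝ) * ((((L ^ n : ℕ) : ℝ)) ^ d)⁻¹ := fun b => by
    rw [loopPull_closed L hL n y μ ν]
    exact abs_blockSum_sqBdry_le (L ^ n) (pow_pos hL n) y μ ν b
  have hθ : (0 : ℝ) ≤ ((L ^ n : ℕ) : ℝ) * ((((L ^ n : ℕ) : ℝ)) ^ d)⁻¹ := by positivity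
  calc ∑ b ∈ S, ((pull L)^[n] (sqBdry 1 y μ ν)) b ^ 2
      ≤ ∑ b ∈ S, |((pull L)^[n] (sqBdry 1 y μ ν)) b| * (((L ^ n : ℕ) : ℝ) * ((((L ^ n : ℕ) : ℝ)) ^ d)⁻¹) :=
        Finset.sum_le_sum fun b _ => by
          rw [← sq_abs, sq]
          exact mul_le_mul_of_nonneg_left (hsup b) (abs_nonneg _)
    _ = (∑ b ∈ S, |((pull L)^[n] (sqBdry 1 y μ ν)) b|) * (((L ^ n : ℕ) : ℝ) * ((((L ^ n : ℕ) : ℝ)) ^ d)⁻¹) := by rw [Finset.sum_mul]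
    _ ≤ 4 * ((L ^ n : ℕ) : ℝ) * (((L ^ n : ℕ) : ℝ) * ((((L ^ n : ℕ) : ℝ)) ^ d)⁻¹) :=
        mul_le_mul_of_nonneg_right (sum_abs_loopPull_le L hL n y μ ν S) hθ

/-- **… IN CLOSED FORM: `Σ_{b∈S} w_b² ≤ 4·L^{(2−d)n}`** [folklore ∘ `T4LoopPullback.rate_eq_zpow`] — the young rate SQUARED: geometric in the number of
levels with ratio `L^{2−d}` (`< 1` for `d ≥ 3`, `L ≥ 2`; in `d = 4`, `L^{−2}` per level). -/
theorem sum_sq_loopPull_le_zpow (L : ℕ) (hL : 0 < L) (n : ℕ) (y : Fin d → ℤ) (μ ν : Fin d) (S : Finset (ZdEdge d)) :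
    ∑ b ∈ S, ((pull L)^[n] (sqBdry 1 y μ ν)) b ^ 2 ≤ 4 * (L : ℝ) ^ ((2 - (d : ℤ)) * n) := by
  have hLr : (L : ℝ) ≠ 0 := by exact_mod_cast hL.ne'
  refine (sum_sq_loopPull_le L hL n y μ ν S).trans (le_of_eq ?_)
  rw [rate_eq_zpow L hL n, mul_assoc]
  congr 1
  push_cast
  rw [← zpow_natCast, ← zpow_add₀ hLr]
  congr 1
  ring

end LoopPull

/-! ## §2 The cosine read-out observable `G(b, x) = B₀·cos(φ b + ⟪w, x⟫)`: the engine's four observable letters -/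
section ReadOut

variable {B : Type*} {m : ℕ} {φ : B → ℝ} {w : EuclideanSpace ℝ (Fin m)} {B₀ : ℝ}

/-- The read-out is measurable (for a measurable block-field angle `φ`). [folklore] -/
theorem measurable_cosReadOut [MeasurableSpace B] (hφ : Measurable φ) (w : EuclideanSpace ℝ (Fin m)) (B₀ : ℝ) :
    Measurable fun p : B × EuclideanSpace ℝ (Fin m) => B₀ * Real.cos (φ p.1 + ⟪w, p.2⟫) := by
  have hi : Measurable fun p : B × EuclideanSpace ℝ (Fin m) => ⟪w, p.2⟫ := (innerSL ℝ w).continuous.measurable.comp measurable_snd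
  exact (Real.measurable_cos.comp ((hφ.comp measurable_fst).add hi)).const_mul B₀

/-- The read-out is `C¹` (indeed smooth) along every fibre. [folklore] -/
theorem contDiff_cosReadOut (b : B) (w : EuclideanSpace ℝ (Fin m)) (B₀ : ℝ) :
    ContDiff ℝ 1 fun x : EuclideanSpace ℝ (Fin m) => B₀ * Real.cos (φ b + ⟪w, x⟫) :=
  (Real.contDiff_cos.comp (contDiff_const.add (innerSL ℝ w).contDiff)).const_smul B₀

/-- The read-out is bounded by `B₀` (`B₀ ≥ 0`). [folklore] -/
theorem abs_cosReadOut_le (hB₀ : 0 ≤ B₀) (p : B × EuclideanSpace ℝ (Fin m)) : |B₀ * Real.cos (φ p.1 + ⟪w, p.2⟫)| ≤ B₀ := by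
  rw [abs_mul, abs_of_nonneg hB₀]
  exact mul_le_of_le_one_right hB₀ (Real.abs_cos_le_one _)

/-- The fibre derivative of the read-out: `D_x G(b, ·) = (−B₀·sin(φ b + ⟪w, x⟫)) • ⟪w, ·⟫`. [folklore] -/
theorem hasFDerivAt_cosReadOut (b : B) (w : EuclideanSpace ℝ (Fin m)) (B₀ : ℝ) (x : EuclideanSpace ℝ (Fin m)) :
    HasFDerivAt (fun z : EuclideanSpace ℝ (Fin m) => B₀ * Real.cos (φ b + ⟪w, z⟫))
      ((B₀ * -Real.sin (φ b + ⟪w, x⟫)) • innerSL ℝ w) x := by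
  have h1 : HasFDerivAt (fun z : EuclideanSpace ℝ (Fin m) => φ b + ⟪w, z⟫) (innerSL ℝ w) x :=
    ((innerSL ℝ w).hasFDerivAt).const_add (φ b)
  have h2 := (Real.hasDerivAt_cos (φ b + ⟪w, x⟫)).comp_hasFDerivAt x h1
  have h3 := h2.const_mul B₀
  rw [← smul_assoc, smul_eq_mul] at h3
  exact h3

/-- **THE FIBRE GRADIENT OF THE READ-OUT IS `≤ B₀‖w‖`** [folklore] (`|sin| ≤ 1`, `‖⟪w, ·⟫‖ = ‖w‖`) — the engine's letter `L = B₀‖w‖`, the young rate of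
the pulled-back loop times the read-out's Lipschitz constant. -/
theorem norm_fderiv_cosReadOut_le (hB₀ : 0 ≤ B₀) (b : B) (w : EuclideanSpace ℝ (Fin m)) (x : EuclideanSpace ℝ (Fin m)) :
    ‖fderiv ℝ (fun z : EuclideanSpace ℝ (Fin m) => B₀ * Real.cos (φ b + ⟪w, z⟫)) x‖ ≤ B₀ * ‖w‖ := by
  rw [(hasFDerivAt_cosReadOut (φ := φ) b w B₀ x).fderiv, norm_smul, innerSL_apply_norm, Real.norm_eq_abs, abs_mul, abs_of_nonneg hB₀]
  exact mul_le_mul_of_nonneg_right (mul_le_of_le_one_right hB₀ (by rw [abs_neg]; exact Real.abs_sin_le_one _)) (norm_nonneg _)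

/-- **TRANSFER OF THE ℓ²-SIZE TO THE FIBRE COORDINATES** [folklore]: if the fibre's Euclidean coordinates read a bond chain `c` along an injection
`ι` (`w i = c (ι i)`) and `c` has `Σ_{b∈S} (c b)² ≤ A` on every finite bond set `S`, then `‖w‖² ≤ A` — with §1, `‖w‖² ≤ 4·L^{(2−d)n}` for the
pulled-back unit loop.  (The identification of fibre coordinates with fine bond variables is the MODEL's hypothesis, displayed here.) -/
theorem norm_sq_le_of_coords {β : Type*} [DecidableEq β] {c : β → ℝ} {ι : Fin m → β} {A : ℝ} (hι : Function.Injective ι)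
    (hw : ∀ i, w i = c (ι i)) (hc : ∀ S : Finset β, ∑ b ∈ S, c b ^ 2 ≤ A) : ‖w‖ ^ 2 ≤ A := by
  rw [EuclideanSpace.norm_sq_eq]
  have e : ∑ i, ‖w i‖ ^ 2 = ∑ b ∈ Finset.univ.image ι, c b ^ 2 := by
    rw [Finset.sum_image fun i _ j _ h => hι h]
    exact Finset.sum_congr rfl fun i _ => by rw [Real.norm_eq_abs, sq_abs, hw i]
  rw [e]
  exact hc _

end ReadOut

/-! ## §3 Square-summability of the gradients on the model -/
section Summable

/-- `L ≥ 2`, `d ≥ 3` ⇒ the per-level ratio of the squared young rate is `L^{2−d} < 1`. [folklore] -/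
theorem zpow_two_sub_lt_one {L d : ℕ} (hL : 2 ≤ L) (hd : 3 ≤ d) : (L : ℝ) ^ (2 - (d : ℤ)) < 1 := by
  have hL1 : (1 : ℝ) < L := by exact_mod_cast hL
  have hneg : (2 : ℤ) - d < 0 := by omega
  exact zpow_lt_one_of_neg₀ hL1 hneg

/-- The closed form of §1 is geometric: `L^{(2−d)n} = (L^{2−d})ⁿ`. [folklore] -/
theorem zpow_mul_natCast_eq_pow {L : ℕ} (hL : 0 < L) (d n : ℕ) : (L : ℝ) ^ ((2 - (d : ℤ)) * n) = ((L : ℝ) ^ (2 - (d : ℤ))) ^ n := by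
  have hLr : (L : ℝ) ≠ 0 := by exact_mod_cast hL.ne'
  rw [zpow_mul, zpow_natCast]

/-- **K's HYPOTHESIS `hL2` ON THE MODEL** [folklore]: gradient vectors with `‖w K‖² ≤ A·ρ^K`, `0 ≤ ρ < 1` (§1–§2: `A = 4`, `ρ = L^{2−d}` up to the
index shift of the tower) give square-summable letters `Σ (B₀‖w K‖)² < ∞`. -/
theorem summable_gradient_sq {m : ℕ → ℕ} {w : ∀ K, EuclideanSpace ℝ (Fin (m K))} {A ρ B₀ : ℝ} (hρ : 0 ≤ ρ) (hρ1 : ρ < 1)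
    (hw : ∀ K, ‖w K‖ ^ 2 ≤ A * ρ ^ K) : Summable fun K => (B₀ * ‖w K‖) ^ 2 := by
  have hA : Summable fun K => B₀ ^ 2 * (A * ρ ^ K) := ((summable_geometric_of_lt_one hρ hρ1).mul_left A).mul_left _
  refine Summable.of_nonneg_of_le (fun K => sq_nonneg _) (fun K => ?_) hA
  rw [mul_pow]
  exact mul_le_mul_of_nonneg_left (hw K) (sq_nonneg _)

end Summable

/-! ## §4 The instance: K's Cauchy theorem with the cosine read-out observables, the four observable letters discharged -/
section Instance

variable {Ω : ℕ → Type*} [∀ K, MeasurableSpace (Ω K)] {m : ℕ → ℕ} {l₀ B₀ C vol : ℝ} {L δ ε : ℕ → ℝ}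
  {μ ν : ∀ K, Measure (Ω K)} {κ : ∀ K, Kernel (Ω K) (EuclideanSpace ℝ (Fin (m K)))}
  {φ : ∀ K, Ω K → ℝ} {w : ∀ K, EuclideanSpace ℝ (Fin (m K))} {g : ∀ K, Ω K → ℝ}
  {e : ∀ K, Ω K × EuclideanSpace ℝ (Fin (m K)) → Ω (K + 1)} {F : ∀ K, Ω K → ℝ} {Z : ℕ → ℝ → ℝ}

/-- **THE GENERATING FUNCTIONS OF THE LOOP-MODEL TOWER ARE CAUCHY** [folklore ∘ K's `cauchySeq_genFun_of_schemaTower` + §2].  The schema tower of file K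
whose run-`K+1` observable in split coordinates is the cosine read-out `B₀·cos(φ K b + ⟪w K, x⟫)` (`φ K` measurable, `B₀ ≥ 0`) with gradient letters
`B₀‖w K‖ ≤ L K`, `0 < L K`, `Σ (L K)² < ∞` (§3 on the model): for every `|t| ≤ l₀` the sequence `K ↦ genFun Z K t` is Cauchy.  Displayed and NOT
produced: the fibres' schema `C`, the law defects `δ K`, the observable defects `ε K` (run `K`'s observable vs the fibre average of the read-out), the
tower shape `μ (K+1) = (ν K ⊗ₘ κ K).map (e K)`, `μ K = (ν K).tilted (g K)`. -/
theorem cauchySeq_genFun_of_loopTower (hvol : 0 < vol) (hl₀ : 0 ≤ l₀) (hC : 0 < C) (hB₀ : 0 ≤ B₀) (hν : ∀ K, IsProbabilityMeasure (ν K))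
    (hκM : ∀ K, IsMarkovKernel (κ K)) (hκC : ∀ K b, HasEntropyExpC1c (κ K b) C) (hφ : ∀ K, Measurable (φ K))
    (hwL : ∀ K, B₀ * ‖w K‖ ≤ L K) (hL : ∀ K, 0 < L K) (hL2 : Summable fun K => L K ^ 2) (hgm : ∀ K, Measurable (g K))
    (hδ0 : ∀ K, 0 ≤ δ K) (hgb : ∀ K b, |g K b| ≤ δ K) (hδ : Summable δ) (he : ∀ K, Measurable (e K)) (hFm : ∀ K, Measurable (F K))
    (hFb : ∀ K x, |F K x| ≤ B₀) (hFe : ∀ K p, F (K + 1) (e K p) = B₀ * Real.cos (φ K p.1 + ⟪w K, p.2⟫)) (hε0 : ∀ K, 0 ≤ ε K)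
    (hε : ∀ K b, |F K b - ∫ x, B₀ * Real.cos (φ K b + ⟪w K, x⟫) ∂(κ K b)| ≤ ε K) (hεs : Summable ε)
    (hA : ∀ K, μ K = (ν K).tilted (g K)) (hB : ∀ K, μ (K + 1) = ((ν K) ⊗ₘ κ K).map (e K)) (hZ : ∀ K t, Z K t = mgf (F K) (μ K) t)
    {t : ℝ} (ht : |t| ≤ l₀) : CauchySeq fun K => genFun Z K t :=
  cauchySeq_genFun_of_schemaTower (G := fun K p => B₀ * Real.cos (φ K p.1 + ⟪w K, p.2⟫)) hvol hl₀ hC hB₀ hν hκM hκC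
    (fun K => measurable_cosReadOut (hφ K) (w K) B₀) (fun K b => contDiff_cosReadOut (φ := φ K) b (w K) B₀)
    (fun K p => abs_cosReadOut_le (φ := φ K) (w := w K) hB₀ p)
    (fun K b x => (norm_fderiv_cosReadOut_le (φ := φ K) hB₀ b (w K) x).trans (hwL K)) hL hL2 hgm hδ0 hgb hδ he hFm hFb hFe hε0
    (fun K b => hε K b) hεs hA hB hZ ht

end Instance

end YMDAG.N14.ConvexFibreLoopModel

end
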